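import Literature.NumberTheory.Irrationality.Zudilin2014.SecondTale

/-!
# Zudilin 2014, second tale: COMPUTABLE evaluation twins of `A_k`, `B_k`, `q̂`, `p̂` (kernel-decidable rational values)

Topic `Literature/NumberTheory/Irrationality/Zudilin2014` [Zudilin2014ZetaTwo, Section 6, Proposition 3].  The typed objects
`coefAT`, `coefBT`, `formQT`, `formPT` of `SecondTale` go through `Polynomial ℚ` (`numT`, `dhatT`, `derivative`, `eval`), which the
kernel cannot evaluate (`Finsupp` is classical).  This file gives DIVISION-FREE EVALUATION TWINS — the same products and their
product-rule derivatives written directly as `Finset` products/sums of rationals (`prodX`, `prod2X`, `dprodX`, `dprod2X`, `numTev`,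
`dnumTev`, `dhatTev`, `ddhatTev`, `qpolyTev`, `dqpolyTev`) — and proves the typed objects EQUAL to them with no hypotheses:
`coefAT_eq_ev`, `coefBT_eq_ev`, `formQT_eq_ev`, `formPT_eq_ev`.  Consequently `formQT a b`, `formPT a b` at numeral data are
`decide`-able through `formQTev`, `formPTev` (use: the BASE table of the two-tale identity (bmiss), cell pub-zeta5
`Summits/…/Zeta5Search/Certificates/TwoTaleOmegaBaseQ`).  Pure algebra of evaluation; no new mathematical content.
Cell pub-zeta5 (HONEST FRAMING: systematic search; no irrationality claim unless certified).
-/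

noncomputable section

open Polynomial Finset

namespace Literature.NumberTheory.Irrationality.Zudilin2014

/-! ### Products of linear factors and their derivatives, evaluated -/

/-- `∏_{i∈s} (x + i)`. [cite: Zudilin2014ZetaTwo, Section 6 (definition of R̂)] -/
def prodX (s : Finset ℤ) (x : ℚ) : ℚ := ∏ i ∈ s, (x + i)

/-- `∏_{ℓ∈s} (2x + ℓ)`. [cite: Zudilin2014ZetaTwo, Section 6 (definition of R̂)] -/
def prod2X (s : Finset ℤ) (x : ℚ) : ℚ := ∏ l ∈ s, (2 * x + l)

/-- `(∏_{i∈s} (X + i))′(x) = Σ_{i∈s} ∏_{j≠i} (x + j)` (product rule, division-free). [cite: Zudilin2014ZetaTwo, Section 6, eq. (T3a)] -/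
def dprodX (s : Finset ℤ) (x : ℚ) : ℚ := ∑ i ∈ s, ∏ j ∈ s.erase i, (x + j)

/-- `(∏_{ℓ∈s} (2X + ℓ))′(x) = Σ_{ℓ∈s} 2 ∏_{j≠ℓ} (2x + j)`. [cite: Zudilin2014ZetaTwo, Section 6, eq. (T3a)] -/
def dprod2X (s : Finset ℤ) (x : ℚ) : ℚ := ∑ l ∈ s, (∏ j ∈ s.erase l, (2 * x + j)) * 2

/-- Evaluation of `∏ (X + C i)`. [cite: Zudilin2014ZetaTwo, Section 6] -/
theorem eval_prodX (s : Finset ℤ) (x : ℚ) : (∏ i ∈ s, (X + C (i : ℚ))).eval x = prodX s x := by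
  unfold prodX; rw [eval_prod]; simp

/-- Evaluation of `∏ (2X + C ℓ)`. [cite: Zudilin2014ZetaTwo, Section 6] -/
theorem eval_prod2X (s : Finset ℤ) (x : ℚ) : (∏ l ∈ s, (C (2 : ℚ) * X + C (l : ℚ))).eval x = prod2X s x := by
  unfold prod2X; rw [eval_prod]; simp

/-- Evaluation of the derivative of `∏ (X + C i)`. [cite: Zudilin2014ZetaTwo, Section 6, eq. (T3a)] -/
theorem eval_derivative_prodX (s : Finset ℤ) (x : ℚ) : (derivative (∏ i ∈ s, (X + C (i : ℚ)))).eval x = dprodX s x := by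
  unfold dprodX
  rw [derivative_prod_finset, eval_finsetSum]
  refine sum_congr rfl fun i _ => ?_
  rw [eval_mul, derivative_add, derivative_X, derivative_C, add_zero, eval_one, mul_one, eval_prod]
  simp

/-- Evaluation of the derivative of `∏ (2X + C ℓ)`. [cite: Zudilin2014ZetaTwo, Section 6, eq. (T3a)] -/
theorem eval_derivative_prod2X (s : Finset ℤ) (x : ℚ) :
    (derivative (∏ l ∈ s, (C (2 : ℚ) * X + C (l : ℚ)))).eval x = dprod2X s x := by
  unfold dprod2X
  rw [derivative_prod_finset, eval_finsetSum]
  refine sum_congr rfl fun l _ => ?_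
  rw [eval_mul, derivative_add, derivative_C_mul, derivative_X, derivative_C, add_zero, mul_one, eval_C, eval_prod]
  simp

/-! ### `numT`, `dhatT`, `qpolyT` and their derivatives, evaluated -/

/-- `numT(x) = Π̂ · ∏(2x+ℓ) · ∏(x+i)`. [cite: Zudilin2014ZetaTwo, Section 6 (definition of R̂)] -/
def numTev (a b : Fin 4 → ℤ) (x : ℚ) : ℚ := normT a b * (prod2X (Ico (b 0) (a 0)) x * prodX (Ico (b 1) (a 1)) x)

/-- `numT′(x)` by the product rule. [cite: Zudilin2014ZetaTwo, Section 6, eq. (T3a)] -/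
def dnumTev (a b : Fin 4 → ℤ) (x : ℚ) : ℚ :=
  normT a b * (dprod2X (Ico (b 0) (a 0)) x * prodX (Ico (b 1) (a 1)) x + prod2X (Ico (b 0) (a 0)) x * dprodX (Ico (b 1) (a 1)) x)

/-- `dhatT_k(x) = ∏_{i≠k}(x+i) ∏_{i≠k}(x+i)`. [cite: Zudilin2014ZetaTwo, Section 6, eq. (T2)] -/
def dhatTev (a b : Fin 4 → ℤ) (k : ℤ) (x : ℚ) : ℚ := prodX ((Ico (a 2) (b 2)).erase k) x * prodX ((Ico (a 3) (b 3)).erase k) x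

/-- `dhatT_k′(x)` by the product rule. [cite: Zudilin2014ZetaTwo, Section 6, eq. (T3a)] -/
def ddhatTev (a b : Fin 4 → ℤ) (k : ℤ) (x : ℚ) : ℚ :=
  dprodX ((Ico (a 2) (b 2)).erase k) x * prodX ((Ico (a 3) (b 3)).erase k) x
    + prodX ((Ico (a 2) (b 2)).erase k) x * dprodX ((Ico (a 3) (b 3)).erase k) x

/-- `qpolyT_k(x) = numT(x) (x+k)^{2−mult}`. [cite: Zudilin2014ZetaTwo, Section 6, eq. (T2)] -/
def qpolyTev (a b : Fin 4 → ℤ) (k : ℤ) (x : ℚ) : ℚ := numTev a b x * (x + k) ^ (2 - multT a b k)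

/-- `qpolyT_k′(x)` by the product rule. [cite: Zudilin2014ZetaTwo, Section 6, after eq. (T2)] -/
def dqpolyTev (a b : Fin 4 → ℤ) (k : ℤ) (x : ℚ) : ℚ :=
  dnumTev a b x * (x + k) ^ (2 - multT a b k)
    + numTev a b x * (((2 - multT a b k : ℕ) : ℚ) * (x + k) ^ (2 - multT a b k - 1))

/-- `numT.eval = numTev`. [cite: Zudilin2014ZetaTwo, Section 6] -/
theorem eval_numT (a b : Fin 4 → ℤ) (x : ℚ) : (numT a b).eval x = numTev a b x := by
  unfold numT numTev block2 block
  rw [eval_mul, eval_C, eval_mul, eval_prod2X, eval_prodX]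

/-- `numT′.eval = dnumTev`. [cite: Zudilin2014ZetaTwo, Section 6, eq. (T3a)] -/
theorem eval_derivative_numT (a b : Fin 4 → ℤ) (x : ℚ) : (derivative (numT a b)).eval x = dnumTev a b x := by
  unfold numT dnumTev block2 block
  rw [derivative_mul, derivative_C, zero_mul, zero_add, derivative_mul, eval_mul, eval_C, eval_add, eval_mul, eval_mul,
    eval_derivative_prod2X, eval_prodX, eval_prod2X, eval_derivative_prodX]

/-- `dhatT.eval = dhatTev`. [cite: Zudilin2014ZetaTwo, Section 6, eq. (T2)] -/
theorem eval_dhatT (a b : Fin 4 → ℤ) (k : ℤ) (x : ℚ) : (dhatT a b k).eval x = dhatTev a b k x := by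
  unfold dhatT dhatTev
  rw [eval_mul, eval_prodX, eval_prodX]

/-- `dhatT′.eval = ddhatTev`. [cite: Zudilin2014ZetaTwo, Section 6, eq. (T3a)] -/
theorem eval_derivative_dhatT' (a b : Fin 4 → ℤ) (k : ℤ) (x : ℚ) :
    (derivative (dhatT a b k)).eval x = ddhatTev a b k x := by
  unfold dhatT ddhatTev
  rw [derivative_mul, eval_add, eval_mul, eval_mul, eval_derivative_prodX, eval_prodX, eval_prodX, eval_derivative_prodX]

/-- `qpolyT.eval = qpolyTev`. [cite: Zudilin2014ZetaTwo, Section 6, eq. (T2)] -/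
theorem eval_qpolyT (a b : Fin 4 → ℤ) (k : ℤ) (x : ℚ) : (qpolyT a b k).eval x = qpolyTev a b k x := by
  unfold qpolyT qpolyTev
  rw [eval_mul, eval_pow, eval_add, eval_X, eval_C, eval_numT]

/-- `qpolyT′.eval = dqpolyTev`. [cite: Zudilin2014ZetaTwo, Section 6, after eq. (T2)] -/
theorem eval_derivative_qpolyT (a b : Fin 4 → ℤ) (k : ℤ) (x : ℚ) :
    (derivative (qpolyT a b k)).eval x = dqpolyTev a b k x := by
  unfold qpolyT dqpolyTev
  rw [derivative_mul, derivative_pow, derivative_add, derivative_X, derivative_C, add_zero, mul_one, eval_add, eval_mul,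
    eval_mul, eval_pow, eval_add, eval_X, eval_C, eval_mul, eval_C, eval_pow, eval_add, eval_X, eval_C, eval_numT,
    eval_derivative_numT]

/-! ### The twins of `A_k`, `B_k`, `q̂`, `p̂` -/

/-- Evaluation twin of `A_k`. [cite: Zudilin2014ZetaTwo, Section 6, eq. (T2)] -/
def coefATev (a b : Fin 4 → ℤ) (k : ℤ) : ℚ := qpolyTev a b k (-(k : ℚ)) / dhatTev a b k (-(k : ℚ))

/-- Evaluation twin of `B_k` (quotient rule). [cite: Zudilin2014ZetaTwo, Section 6, after eq. (T2)] -/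
def coefBTev (a b : Fin 4 → ℤ) (k : ℤ) : ℚ :=
  (dqpolyTev a b k (-(k : ℚ)) * dhatTev a b k (-(k : ℚ)) - qpolyTev a b k (-(k : ℚ)) * ddhatTev a b k (-(k : ℚ)))
    / dhatTev a b k (-(k : ℚ)) ^ 2

/-- `A_k = coefATev k`. [cite: Zudilin2014ZetaTwo, Section 6, eq. (T2)] -/
theorem coefAT_eq_ev (a b : Fin 4 → ℤ) (k : ℤ) : coefAT a b k = coefATev a b k := by
  unfold coefAT coefATev
  rw [eval_qpolyT, eval_dhatT]

/-- `B_k = coefBTev k`. [cite: Zudilin2014ZetaTwo, Section 6, after eq. (T2)] -/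
theorem coefBT_eq_ev (a b : Fin 4 → ℤ) (k : ℤ) : coefBT a b k = coefBTev a b k := by
  unfold coefBT coefBTev
  rw [eval_derivative_qpolyT, eval_dhatT, eval_qpolyT, eval_derivative_dhatT']

/-- Evaluation twin of `q̂`. [cite: Zudilin2014ZetaTwo, Proposition 3] -/
def formQTev (a b : Fin 4 → ℤ) : ℚ := signT b * ∑ k ∈ Ico (aMax3 a) (bMin b), coefATev a b k

/-- Evaluation twin of `p̂`. [cite: Zudilin2014ZetaTwo, proof of Proposition 3] -/
def formPTev (a b : Fin 4 → ℤ) : ℚ :=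
  signT b * (∑ k ∈ Ico (aMax3 a) (bMin b), 2 * coefATev a b k * harmAlt2 (2 * k - a0star a).toNat
    + ∑ k ∈ Ico (aMid a) (bMax b), coefBTev a b k * harmAlt1 (2 * k - a0star a).toNat)

/-- `q̂ = formQTev` (so `formQT` at numerals is `decide`-able). [cite: Zudilin2014ZetaTwo, Proposition 3] -/
theorem formQT_eq_ev (a b : Fin 4 → ℤ) : formQT a b = formQTev a b := by
  unfold formQT formQTev
  simp only [coefAT_eq_ev]

/-- `p̂ = formPTev` (so `formPT` at numerals is `decide`-able). [cite: Zudilin2014ZetaTwo, proof of Proposition 3] -/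
theorem formPT_eq_ev (a b : Fin 4 → ℤ) : formPT a b = formPTev a b := by
  unfold formPT formPTev
  simp only [coefAT_eq_ev, coefBT_eq_ev]

/-- Kernel sanity check at Zudilin-type data `â = (6,3,3,3)`, `b̂ = (4,3,6,4)` (the two-tale point `(a,b,e,f,g) = (3,1,3,3,4)`):
`q̂ = 1`, `p̂ = 13/8`. [cite: Zudilin2014ZetaTwo, Proposition 3] -/
theorem formQTev_formPTev_example : formQTev ![6, 3, 3, 3] ![4, 3, 6, 4] = 1 ∧ formPTev ![6, 3, 3, 3] ![4, 3, 6, 4] = 13 / 8 := by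
  constructor <;> decide +kernel

end Literature.NumberTheory.Irrationality.Zudilin2014

end
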